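import Literature.NumberTheory.Automorphic.CDTTheorem712TwoLiftsProofs
import Literature.NumberTheory.Automorphic.TunnellOctahedralGlobal
import Literature.NumberTheory.Automorphic.QuadraticHeckeCharacter
import Literature.NumberTheory.Automorphic.ArchHeckeTestVectorGammaGL2
import Literature.NumberTheory.Automorphic.AutomorphicRepsGLSatakeFlathProofs
import Literature.NumberTheory.QuadraticForms.HilbertReciprocityRat
import Literature.NumberTheory.GaloisRepresentations.ModPGaloisRepLevelProofs
import Literature.NumberTheory.GaloisRepresentations.ArtinConductorProofs
import Literature.NumberTheory.GaloisRepresentations.GaloisRepFrobeniusProofs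
import HarnessLib

/-!
# Stub ideas for `stub_modThree` — ideator k = 2, generation 6 (HOME FAMILY 2 — RESHAPE)

Companion to `STUB-IDEAS-stub_modThree-2.md` (crux `FreyModularity`, route `DefiniteXi`).

The registered stub

  `stub_modThree : ∀ W [W.IsElliptic] (ρ : ModPGaloisRep ℚ (ZMod 3) 2),`
  `  W.IsTorsionGaloisRep 3 ρ → FramedRep.IsAbsolutelyIrreducible ρ → ρ.IsModular`

is the Langlands–Tunnell step of Wiles' 3–5 trick.  The tree already closes it from seven catalogued
named facts (`langlands_tunnell_of_baseChange`, all glue proved) — §0 records that audit as a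
kernel-checked composition.  The RESHAPE of this generation is **leaf localisation to the base field
`ℚ`**: every leaf of Tunnell's architecture is re-cut to the instance the stub actually consumes
(`F = ℚ`, `E` = the `A₄`-field `= ℚ(ζ₃)` since `det ρ̄ = χ₃`, `K` cubic), after which

* the quadratic-twist leaf `exists_twist_quadraticSign` is **discharged** over `ℚ` by the tree's
  Hilbert reciprocity over `ℚ` (`hilbertReciprocity_rat`) — §1, proved here;
* Gelbart's Prop. 4.1 `frobSatakeCompatibleAt_of_isPiOfArtinRep` (the unproved "`π` unramified ⇒
  `σ` unramified" direction) is **replaced** by its proved `σ`-unramified twin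
  `frobSatakeCompatibleAt_of_isPiOfArtinRep_of_isUnramifiedAt_holds` plus Satake uniqueness
  (`hasSatakeParamAt_unique_holds`) and the helper `CondUnramifiedRat`
  ("`p ∤ N(σ) ⇒ σ` unramified at `p`", Serre *Local Fields* VI §2), **proved here** — §2–§3;
* cyclic descent (Arthur–Clozel III.4.2 (d), all `n`, all prime degrees) narrows to **quadratic
  descent for `GL₂`** (Langlands 1980, §2 B)) — §4;
* the octahedral case and the Klein case split are re-proved **per base field** from these local
  leaves (verbatim copies of the tree proofs) — §4–§5;

so that the closer §6 `stub_modThree_of_fiveLeaves'` has FIVE catalogued leaves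
(`hd`, `ht`, `cuspidal_descent_cyclic` — only its quadratic `GL₂` instance
`QuadraticDescentGL2Over ℚ` is consumed —, `tunnell_lemma`, `hW1`) instead of seven, every piece
of reshaped glue being kernel-checked (`#print axioms stub_modThree_of_fiveLeaves'` =
`[propext, Classical.choice, Quot.sound]`).  Sorries: exactly one, the OPTIONAL finite-group stub
`stub_not_isTetrahedralType_of_det` (§5; not used by any closer).
-/

noncomputable section

open scoped MatrixGroups NumberField Polynomial Classical ModularForm
open NumberField IsDedekindDomain Field Polynomial Filter CongruenceSubgroup
open Literature.NumberTheory Literature.NumberTheory.QuadraticForms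
open Literature.NumberTheory.GaloisRepresentations Literature.NumberTheory.Automorphic
open Literature.NumberTheory.Automorphic.BCDT
open Literature.NumberTheory.EllipticCurves.ModularForms Rat.HeightOneSpectrum
open WeierstrassCurve

namespace Summit.ABC.ABC.Cruxes.FreyModularity.Sketch.StubIdeasModThreeK2G6

/-- The registered stub's signature, verbatim. -/
abbrev SigStubModThree : Prop :=
  ∀ (W : WeierstrassCurve ℚ) [W.IsElliptic] (ρ : ModPGaloisRep ℚ (ZMod 3) 2),
    W.IsTorsionGaloisRep 3 ρ → FramedRep.IsAbsolutelyIrreducible ρ → ρ.IsModular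

/-! ## §0  Debt audit: the typed stub is already closed by the tree's Tunnell assembly -/

/-- **T0 (audit, 0 sorry).** The stub from the seven catalogued leaves of
`langlands_tunnell_of_baseChange` (the Satake facts `hSU`, `hSC` being the theorems
`hasSatakeParamAt_unique_holds`, `hasSatakeParamAt_cofinite_holds`). -/
theorem stub_modThree_of_sevenLeaves
    (hd : strongArtin_of_isDihedralType) (ht : strongArtin_of_isTetrahedralType)
    (hdesc : cuspidal_descent_cyclic) (htw : exists_twist_quadraticSign) (hL : tunnell_lemma)
    (hAE : frobSatakeCompatibleAt_of_isPiOfArtinRep) (hW1 : exists_isNewform1_of_isPiOfArtinRep) :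
    SigStubModThree :=
  modThree_of_langlands_tunnell fun σ =>
    langlands_tunnell_of_baseChange hd ht hdesc htw hL
      (fun π => AutomorphicRepData.hasSatakeParamAt_unique_holds π)
      (fun π => AutomorphicRepData.hasSatakeParamAt_cofinite_holds π) hAE hW1 σ

/-! ## §1  The quadratic-twist leaf, localised to the base field — PROVED over `ℚ` -/

/-- `exists_twist_quadraticSign` with the base field `F` fixed (the leaf is consumed once, at the
base field, in Tunnell's proof: `htw 2 F E hdegE hF π₀`). -/
def TwistQuadraticSignOver (F : Type) [Field F] [NumberField F] : Prop :=
  ∀ (n : ℕ) (E : Type) [Field E] [NumberField E] [Algebra F E],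
    Module.finrank F E = 2 → ∀ (hF : isCompact_glFiniteIntegralLevel n F)
      (π : CuspidalAutomorphicRepData n F hF),
        ∃ π' : CuspidalAutomorphicRepData n F hF,
          ∀ᶠ v : HeightOneSpectrum (𝓞 F) in Filter.cofinite, ∀ α : Multiset ℂ,
            π.1.HasSatakeParamAt v α → π'.1.HasSatakeParamAt v (α.map (quadraticSign E v * ·))

/-- Per-field copy of `exists_twist_quadraticSign_of_range_localUnits_not_le` (O'Meara 71:17 at the
base field only). -/
theorem twistQuadraticSignOver_of_range_localUnits_not_le {F : Type} [Field F] [NumberField F]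
    (h17 : QuadraticForms.range_localUnits_not_le_of_inertiaDegIn_eq_two F) : TwistQuadraticSignOver F := by
  intro n E _ _ _ h2 hF π
  obtain ⟨ω, hωfin, hω⟩ := exists_heckeCharacter_quadraticSign_of_inert (E := E) h17 h2
  refine ⟨π.twist ω hωfin, ?_⟩
  filter_upwards [π.1.eventually_hasSatakeParamAt_twist hωfin, hω] with v hv hωv α hα
  rw [← hωv.2]
  exact hv α hα

/-- **HTW (0 sorry): the quadratic-twist leaf over `ℚ` is a theorem of the tree**, by Hilbert
reciprocity over `ℚ` (`hilbertReciprocity_rat`) ⇒ O'Meara 71:17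
(`range_localUnits_not_le_of_hilbertReciprocity`). -/
theorem twistQuadraticSignOver_rat : TwistQuadraticSignOver ℚ :=
  twistQuadraticSignOver_of_range_localUnits_not_le
    (range_localUnits_not_le_of_hilbertReciprocity ℚ hilbertReciprocity_rat)

/-- Sanity: the global leaf specialises to the local one. -/
theorem twistQuadraticSignOver_of_global (h : exists_twist_quadraticSign) (F : Type) [Field F]
    [NumberField F] : TwistQuadraticSignOver F :=
  fun n E _ _ _ h2 hF π => h n F E h2 hF π

/-! ## §2  The one new helper: primes off the Artin conductor are unramified -/

/-- **HC.** For an Artin representation `σ : Γ_ℚ → GL₂(ℂ)` and a prime `p ∤ N(σ)`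
(`artinConductorNat`), `σ` is unramified at `p`.  Route (one prover cycle, S/M): `σ` has finite
image, so it is unramified a.e. (`eventually_isUnramifiedAt_of_isOpen_ker`), so
`a_w(σ) = 0` a.e. (`artinConductorExponent_eq_zero_of_isUnramifiedAt_holds`) and
`N(σ) = ∏ p_w ^ a_w(σ)` is a genuine product (`GaloisRep.artinConductorNat_rat_eq_finprod`);
`p ∤ N(σ)` forces `a_v(σ) = ⌊𝔣_𝔓(σ)⌋₊ = 0`, i.e. `codim V^{I_𝔓} + sw_𝔓 < 1`, so `codim V^{I_𝔓} = 0`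
(`swanConductorAt_nonneg`, `artinConductorAt_def`, `ContinuousRep.codimFixed_eq_zero_iff`) and
`σ` is unramified at `v` (`isUnramifiedAt_of_isUnramifiedAtPrime_holds`); compare the converse
`not_dvd_artinConductorNat_of_isUnramifiedAt` (`WeightOneOrdinaryLiftGaloisProofs`).
[cite: SerreLocalFields1979, Ch. VI §2, Thm 1'] -/
def CondUnramifiedRat : Prop :=
  ∀ (σ : FramedArtinRep ℚ 2) (v : HeightOneSpectrum (𝓞 ℚ)),
    ¬ ((primesEquiv v : Nat.Primes) : ℕ) ∣ σ.toGaloisRep.artinConductorNat → σ.IsUnramifiedAt v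

/-- **HC is a theorem (0 sorry)** — Serre, *Local Fields* VI §2 through the tree's `_holds`
discharges. [cite: SerreLocalFields1979, Ch. VI §2, Thm 1'] -/
theorem condUnramifiedRat_holds : CondUnramifiedRat := by
  classical
  intro σ v hndvd
  haveI : Finite σ.toMonoidHom.range := finite_range_toMonoidHom σ
  have hunr : ∀ᶠ w in Filter.cofinite, σ.IsUnramifiedAt w :=
    σ.eventually_isUnramifiedAt_of_isOpen_ker (GaloisRepresentations.isOpen_ker_of_finite_range σ)
  set a : HeightOneSpectrum (𝓞 ℚ) → ℕ := fun w ↦ σ.toGaloisRep.artinConductorExponent w with ha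
  set P : HeightOneSpectrum (𝓞 ℚ) → ℕ := fun w ↦ ((primesEquiv w : Nat.Primes) : ℕ) with hP
  have ha0 : ∀ᶠ w in Filter.cofinite, a w = 0 := hunr.mono fun w hw =>
    GaloisRep.artinConductorExponent_eq_zero_of_isUnramifiedAt_holds
      ((FramedGaloisRep.isUnramifiedAt_toGaloisRep_iff w σ).2 hw)
  have hfin : (Function.mulSupport fun w ↦ P w ^ a w).Finite := by
    refine (Filter.eventually_cofinite.mp ha0).subset fun w hw h0 => ?_
    rw [Function.mem_mulSupport] at hw
    exact hw (by change P w ^ a w = 1; rw [h0, pow_zero])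
  have hN : σ.toGaloisRep.artinConductorNat = ∏ᶠ w, P w ^ a w :=
    GaloisRep.artinConductorNat_rat_eq_finprod _
  -- `a v = 0`, else `p_v ∣ N(σ)`
  have hav : a v = 0 := by
    by_contra hne
    apply hndvd
    rw [hN, finprod_eq_prod _ hfin]
    have hPv1 : P v ≠ 1 := (primesEquiv v).2.ne_one
    have hvmem : v ∈ hfin.toFinset := by
      rw [Set.Finite.mem_toFinset, Function.mem_mulSupport]
      change ¬ P v ^ a v = 1
      rw [Nat.pow_eq_one]
      rintro (h | h)
      exacts [hPv1 h, hne h]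
    exact (dvd_pow_self (P v) hne).trans (Finset.dvd_prod_of_mem _ hvmem)
  -- from `a v = 0` to `codim V^{I_𝔓} = 0` to unramified
  have hlt : σ.toGaloisRep.artinConductorAt (𝓞 ℚ) (HeightOneSpectrum.primesAbove_nonempty v).some
      < 1 := by
    have h := hav
    simp only [ha] at h
    unfold GaloisRep.artinConductorExponent at h
    rwa [Nat.floor_eq_zero] at h
  set 𝔓 := (HeightOneSpectrum.primesAbove_nonempty v).some with h𝔓def
  have h𝔓 : 𝔓 ∈ v.primesAbove := (HeightOneSpectrum.primesAbove_nonempty v).some_mem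
  have hcodim : σ.toGaloisRep.codimFixed (𝔓.inertia (absoluteGaloisGroup ℚ)) = 0 := by
    have h1 : (σ.toGaloisRep.codimFixed (𝔓.inertia (absoluteGaloisGroup ℚ)) : ℝ) < 1 := by
      have h0 := σ.toGaloisRep.swanConductorAt_nonneg (R := 𝓞 ℚ) 𝔓
      rw [GaloisRep.artinConductorAt_def] at hlt
      linarith
    have h2 : σ.toGaloisRep.codimFixed (𝔓.inertia (absoluteGaloisGroup ℚ)) < 1 := by
      exact_mod_cast h1
    omega
  have hprime : σ.toGaloisRep.IsUnramifiedAtPrime 𝔓 :=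
    (ContinuousRep.codimFixed_eq_zero_iff _ _).mp hcodim
  exact (FramedGaloisRep.isUnramifiedAt_toGaloisRep_iff v σ).1
    (GaloisRep.isUnramifiedAt_of_isUnramifiedAtPrime_holds h𝔓 hprime)

/-! ## §3  Gelbart Prop. 4.1 replaced by its proved `σ`-unramified twin -/

/-- Strong Artin for solvable `σ`, base field fixed. -/
def SolvableSAOver (F : Type) [Field F] [NumberField F] : Prop :=
  ∀ σ : FramedArtinRep F 2, σ.toGaloisRep.IsIrreducible →
    IsSolvable (projectiveImage σ.toMonoidHom) →
      ∃ (hcpt : isCompact_glFiniteIntegralLevel 2 F) (π : CuspidalAutomorphicRepData 2 F hcpt),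
        IsPiOfArtinRep σ π.1

/-- **HAE-free `ℚ`-assembly (0 sorry beyond the hypothesis `hC`).** Copy of
`langlands_tunnell_of_strongArtin` in which `hAE` is replaced by the theorem
`frobSatakeCompatibleAt_of_isPiOfArtinRep_of_isUnramifiedAt_holds` + Satake uniqueness: the
weight-one dictionary `hW1` already returns the level `N = N(σ)`, so every `p ∤ N` is
`σ`-unramified by `hC`. -/
theorem langlands_tunnell_of_solvableSAOver_rat (hSA : SolvableSAOver ℚ) (hC : CondUnramifiedRat)
    (hW1 : exists_isNewform1_of_isPiOfArtinRep) (ρ : FramedArtinRep ℚ 2) :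
    langlands_tunnell ρ := by
  intro hirr hodd hsolv
  have hproj : IsSolvable (projectiveImage ρ.toMonoidHom) :=
    (isSolvable_projectiveImage_iff _).mpr hsolv
  obtain ⟨hcpt, π, hπ⟩ := hSA ρ hirr hproj
  obtain ⟨N, hN, f, hf, hcond, hsat⟩ := hW1 hcpt ρ π hirr hodd hπ
  refine ⟨N, hN, f, hf, fun v hv => ?_⟩
  obtain ⟨α, hα, hpoly⟩ := hsat v hv
  have hur : ρ.IsUnramifiedAt v := hC ρ v (by rw [hcond]; exact hv)
  obtain ⟨α', hα', -, hchar⟩ :=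
    frobSatakeCompatibleAt_of_isPiOfArtinRep_of_isUnramifiedAt_holds hcpt ρ π hπ v hur
  have hαα : α = α' := AutomorphicRepData.hasSatakeParamAt_unique_holds π.1 hα hα'
  subst hαα
  exact ⟨hur, hpoly ▸ hchar⟩

/-! ## §4  Quadratic descent for `GL₂` and the octahedral case, per base field -/

/-- **Cyclic descent narrowed to what Tunnell's proof consumes**: quadratic descent for cuspidal
representations of `GL₂` (Langlands 1980, §2, property B): "if `Π` is cuspidal then `Π` is a
lifting iff `Π^τ ≅ Π` for all `τ ∈ Gal(E/F)`", a.e. Satake shadow as in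
`cuspidal_descent_cyclic`). [cite: LanglandsBaseChange1980, §2 B)] -/
def QuadraticDescentGL2Over (F : Type) [Field F] [NumberField F] : Prop :=
  ∀ (E : Type) [Field E] [NumberField E] [Algebra F E] [IsGalois F E]
    (hF : isCompact_glFiniteIntegralLevel 2 F) (hE : isCompact_glFiniteIntegralLevel 2 E),
    Module.finrank F E = 2 → ∀ P : CuspidalAutomorphicRepData 2 E hE,
      IsGaloisStableSatakeAE F P.1 →
        ∃ π : CuspidalAutomorphicRepData 2 F hF, IsWeakBaseChangeLiftAE π.1 P.1

/-- The narrowed leaf is an instance of the catalogued one (0 sorry). -/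
theorem quadraticDescentGL2Over_of_cyclic (h : cuspidal_descent_cyclic) (F : Type) [Field F]
    [NumberField F] : QuadraticDescentGL2Over F := by
  intro E _ _ _ _ hF hE h2 P hP
  haveI : Algebra.IsQuadraticExtension F E := { finrank_eq_two' := h2 }
  have hprime : (Module.finrank F E).Prime := by rw [h2]; exact Nat.prime_two
  exact h 2 F E hF hE inferInstance hprime P hP

/-- The octahedral case of strong Artin, base field fixed. -/
def OctahedralSAOver (F : Type) [Field F] [NumberField F] : Prop :=
  ∀ σ : FramedArtinRep F 2, σ.toGaloisRep.IsIrreducible → IsOctahedralType σ.toMonoidHom →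
    ∃ (hcpt : isCompact_glFiniteIntegralLevel 2 F) (π : CuspidalAutomorphicRepData 2 F hcpt),
      IsPiOfArtinRep σ π.1

/-- **Tunnell's theorem per base field from the LOCALISED leaves (0 sorry)** — verbatim copy of
`strongArtin_of_isOctahedralType_of_tunnell_lemma` with `cuspidal_descent_cyclic ↦
QuadraticDescentGL2Over F`, `exists_twist_quadraticSign ↦ TwistQuadraticSignOver F` and the Satake
facts by name. [cite: Tunnell1981, Theorem (p. 174)] -/
theorem octahedralSAOver_of_localLeaves {F : Type} [Field F] [NumberField F]
    (ht : strongArtin_of_isTetrahedralType) (hd : strongArtin_of_isDihedralType)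
    (hdesc2 : QuadraticDescentGL2Over F) (htwF : TwistQuadraticSignOver F) (hL : tunnell_lemma) :
    OctahedralSAOver F := by
  intro σ _ hoct
  obtain ⟨e⟩ := hoct
  haveI : Finite σ.toMonoidHom.range := finite_range_toMonoidHom σ
  have hker : IsOpen (σ.toMonoidHom.ker : Set (absoluteGaloisGroup F)) :=
    GaloisRepresentations.isOpen_ker_of_finite_range σ
  have hunr : ∀ᶠ v in Filter.cofinite, σ.IsUnramifiedAt v :=
    σ.eventually_isUnramifiedAt_of_isOpen_ker hker
  -- the subgroups `A₄` (index 2) and `D₄` (index 3) of the projective image `≅ S₄`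
  obtain ⟨QA, hQAi, hQAc, ⟨eA⟩⟩ := GaloisRepresentations.exists_subgroup_mulEquiv_alternatingGroup_of_mulEquiv_perm e
  obtain ⟨QD, hQDi, hQDc, ⟨eD⟩⟩ := GaloisRepresentations.exists_subgroup_mulEquiv_dihedralGroup_of_mulEquiv_perm e
  -- the fields `E` (quadratic) and `K` (cubic) cut out by them
  obtain ⟨E, hfinE, hdegE, ⟨eE⟩⟩ :=
    GaloisRepresentations.exists_intermediateField_projectiveImage_restrictField σ hker QA
  obtain ⟨K, hfinK, hdegK, ⟨eK⟩⟩ :=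
    GaloisRepresentations.exists_intermediateField_projectiveImage_restrictField σ hker QD
  haveI := hfinE
  haveI := hfinK
  haveI : NumberField E := NumberField.of_module_finite F E
  haveI : NumberField K := NumberField.of_module_finite F K
  rw [hQAi] at hdegE
  rw [hQDi] at hdegK
  haveI : Algebra.IsQuadraticExtension F E := { finrank_eq_two' := hdegE }
  -- `σ_E` is tetrahedral, `σ_K` dihedral (`D₄`); both are irreducible
  haveI : Finite (σ.restrictField E).toMonoidHom.range := finite_range_toMonoidHom _
  haveI : Finite (σ.restrictField K).toMonoidHom.range := finite_range_toMonoidHom _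
  have htet : GaloisRepresentations.IsTetrahedralType (σ.restrictField E).toMonoidHom := ⟨eE.trans eA⟩
  have hirrE : (σ.restrictField E).toGaloisRep.IsIrreducible :=
    (isIrreducible_toStdRepresentation_iff _).mp
      (GaloisRepresentations.isIrreducible_of_not_isCyclicType _ htet.not_isCyclicType)
  have hdih : GaloisRepresentations.IsDihedralType (σ.restrictField K).toMonoidHom := ⟨4, by norm_num, ⟨eK.trans eD⟩⟩
  have hirrK : (σ.restrictField K).toGaloisRep.IsIrreducible :=
    (isIrreducible_toStdRepresentation_iff _).mp
      (GaloisRepresentations.isIrreducible_of_not_isCyclicType _ (GaloisRepresentations.not_isCyclicType_of_mulEquiv_dihedralGroup_four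
        (eK.trans eD)))
  obtain ⟨hE, PE, hPE⟩ := ht (σ.restrictField E) hirrE htet
  obtain ⟨hK, PK, hPK⟩ := hd (σ.restrictField K) hirrK hdih
  have hcardE : Nat.card (GaloisRepresentations.projectiveImage (σ.restrictField E).toMonoidHom) = 12 := by
    rw [Nat.card_congr eE.toEquiv, hQAc]
  have hcardK : Nat.card (GaloisRepresentations.projectiveImage (σ.restrictField K).toMonoidHom) = 8 := by
    rw [Nat.card_congr eK.toEquiv, hQDc]
  -- descent of `Π_E = π(σ_E)` to `F`, and its twist by `η_{E/F}`
  have hF : isCompact_glFiniteIntegralLevel 2 F := isCompact_glFiniteIntegralLevel_holds 2 F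
  have hstab : IsGaloisStableSatakeAE F PE.1 :=
    isGaloisStableSatakeAE_of_isPiOfArtinRep σ hunr PE.1 (AutomorphicRepData.hasSatakeParamAt_unique_holds PE.1) hPE
  obtain ⟨π₀, hlift₀⟩ := hdesc2 E hF hE hdegE PE hstab
  obtain ⟨π₁, htw₁⟩ := htwF 2 E hdegE hF π₀
  have hlift₁ : IsWeakBaseChangeLiftAE π₁.1 PE.1 :=
    hlift₀.of_twist_quadraticSign hdegE htw₁ (AutomorphicRepData.hasSatakeParamAt_unique_holds π₁.1) (AutomorphicRepData.hasSatakeParamAt_cofinite_holds π₀.1)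
  -- Tunnell's lemma: one of `π₀, π₁` lifts weakly to `Π_K = π(σ_K)` as well
  obtain ⟨π, hπE, hπK⟩ : ∃ π : CuspidalAutomorphicRepData 2 F hF,
      IsWeakBaseChangeLiftAE π.1 PE.1 ∧ IsWeakBaseChangeLiftAE π.1 PK.1 := by
    rcases hL F E K hdegE hdegK σ ⟨e⟩ hcardE hcardK hF hE hK PE PK hPE hPK π₀ π₁ hlift₀ hlift₁
      htw₁ with h | h
    exacts [⟨π₀, hlift₀, h⟩, ⟨π₁, hlift₁, h⟩]
  refine ⟨hF, π, ?_⟩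
  -- the local argument at almost every `v`
  have G3 := eventually_forall_under_eq (F := F) (hPE.and hπE)
  have G4 := eventually_forall_under_eq (F := F) (hPK.and hπK)
  refine (((hunr.and (AutomorphicRepData.hasSatakeParamAt_cofinite_holds π.1)).and G3).and G4).mono ?_
  rintro v ⟨⟨⟨hv1, ⟨α, hα⟩⟩, hv3⟩, hv4⟩
  refine ⟨α, hα, hv1, ?_⟩
  obtain ⟨φ, β, hβ, hch, hPv⟩ := exists_frobenius_satakePolynomial σ hv1
  -- `E`-side: `α^f = β^f`, `f ∈ {1, 2}`
  obtain ⟨w, hw⟩ := exists_above (E := E) v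
  obtain ⟨⟨γ, hγ, -, hγP⟩, hwl⟩ := hv3 w hw
  have eγ := eq_map_pow_of_hasFrobCharpolyAt_restrictField σ hv1 hβ hPv hw hγP
  have hαf : α.map (· ^ w.asIdeal.inertiaDeg (𝓞 F)) = β.map (· ^ w.asIdeal.inertiaDeg (𝓞 F)) := by
    rw [← eγ]
    exact AutomorphicRepData.hasSatakeParamAt_unique_holds PE.1 (hwl v α hw hα) hγ
  have hf12 := inertiaDeg_eq_one_or_two_of_finrank_eq_two hdegE v w hw
  -- `K`-side: `α^d = β^d`, `d ∈ {1, 3}`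
  obtain ⟨u, hu, hd13⟩ := exists_place_inertiaDeg_eq_one_or_three hdegK v
  obtain ⟨⟨δ, hδ, -, hδP⟩, hul⟩ := hv4 u hu
  have eδ := eq_map_pow_of_hasFrobCharpolyAt_restrictField σ hv1 hβ hPv hu hδP
  have hαd : α.map (· ^ u.asIdeal.inertiaDeg (𝓞 F)) = β.map (· ^ u.asIdeal.inertiaDeg (𝓞 F)) := by
    rw [← eδ]
    exact AutomorphicRepData.hasSatakeParamAt_unique_holds PK.1 (hul v α hu hα) hδ
  -- no element of order `6` in `S₄`
  have key := tunnell_local_lemma_multiset (ρ := σ.toMonoidHom) ⟨e⟩ φ hα.card_eq hβ hch hf12 hd13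
    hαf hαd
  rw [key]
  exact hPv


/-! ## §5  The Klein case split per base field; the tetrahedral branch is vacuous over `ℚ` -/

/-- Per-field copy of `strongArtin_of_isSolvable_of_three_cases` (0 sorry). -/
theorem solvableSAOver_of_cases {F : Type} [Field F] [NumberField F]
    (hd : strongArtin_of_isDihedralType) (ht : strongArtin_of_isTetrahedralType)
    (ho : OctahedralSAOver F) : SolvableSAOver F := by
  intro σ hirr hsolv
  haveI : Finite σ.toMonoidHom.range := finite_range_toMonoidHom σ
  have hsolv' : IsSolvable σ.toMonoidHom.range := (isSolvable_projectiveImage_iff _).mp hsolv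
  have hirr' : (toStdRepresentation σ.toMonoidHom).IsIrreducible :=
    (isIrreducible_toStdRepresentation_iff σ).mpr hirr
  rcases projectiveType_of_isIrreducible_of_isSolvable' σ.toMonoidHom hirr' hsolv' with h | h | h
  · exact hd σ hirr h
  · exact ht σ hirr h
  · exact ho σ hirr h

/-- **(optional) V-T.** For `ρ̄ : Γ_ℚ → GL₂(𝔽₃)` with `det ρ̄ ≠ 1` (always: `det ρ̄ = χ₃` by the Weil
pairing, `det_eq_modPCyclotomicCharacterZMod_of_exists_weilPairing`), the lift `ψ ∘ ρ̄` is never of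
tetrahedral type: `A₄ = PSL₂(𝔽₃)` and its preimage in `GL₂(𝔽₃)` is `SL₂(𝔽₃)`.  So in §5's split
applied to `modThreeLift ρ` the tetrahedral leaf is only ever used over the quadratic field
`E = ℚ(ζ₃)` (inside the octahedral case), never over `ℚ`.  Finite-group lemma, S/M. -/
theorem stub_not_isTetrahedralType_of_det (ρ : FramedGaloisRep ℚ (ZMod 3) 2)
    (hdet : ∃ g, Matrix.GeneralLinearGroup.det (ρ g) ≠ 1) :
    ¬ IsTetrahedralType (modThreeLift ρ).toMonoidHom := by
  sorry

/-! ## §6  The reshaped closer: five catalogued leaves + one helper -/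

/-- **The typed stub from the LOCALISED leaves** (0 sorry beyond the binders): dihedral and
tetrahedral strong Artin (`hd`, `ht`), quadratic `GL₂` descent over `ℚ`, Tunnell's Lemma, the
weight-one dictionary `hW1`, and the helper `hC`; the twist leaf and Gelbart 4.1 are supplied by
theorems of the tree (`twistQuadraticSignOver_rat`,
`frobSatakeCompatibleAt_of_isPiOfArtinRep_of_isUnramifiedAt_holds`). -/
theorem stub_modThree_of_localLeaves
    (hd : strongArtin_of_isDihedralType) (ht : strongArtin_of_isTetrahedralType)
    (hdesc2 : QuadraticDescentGL2Over ℚ) (hL : tunnell_lemma) (hC : CondUnramifiedRat)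
    (hW1 : exists_isNewform1_of_isPiOfArtinRep) : SigStubModThree :=
  modThree_of_langlands_tunnell fun σ =>
    langlands_tunnell_of_solvableSAOver_rat
      (solvableSAOver_of_cases hd ht
        (octahedralSAOver_of_localLeaves ht hd hdesc2 twistQuadraticSignOver_rat hL))
      hC hW1 σ

/-- Same, with the catalogued descent leaf (so the item's blocked-on list reads: `hd`, `ht`,
`cuspidal_descent_cyclic`, `tunnell_lemma`, `hW1` + helper HC). -/
theorem stub_modThree_of_fiveLeaves
    (hd : strongArtin_of_isDihedralType) (ht : strongArtin_of_isTetrahedralType)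
    (hdesc : cuspidal_descent_cyclic) (hL : tunnell_lemma) (hC : CondUnramifiedRat)
    (hW1 : exists_isNewform1_of_isPiOfArtinRep) : SigStubModThree :=
  stub_modThree_of_localLeaves hd ht (quadraticDescentGL2Over_of_cyclic hdesc ℚ) hL hC hW1

/-- **Headline closer (0 sorry beyond the five catalogued leaves).**  `stub_modThree` from
`strongArtin_of_isDihedralType`, `strongArtin_of_isTetrahedralType`, `cuspidal_descent_cyclic`
(only its `GL₂`/quadratic instance is consumed), `tunnell_lemma` and
`exists_isNewform1_of_isPiOfArtinRep`; the twist leaf, Gelbart 4.1 and the conductor helper are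
theorems (`twistQuadraticSignOver_rat`,
`frobSatakeCompatibleAt_of_isPiOfArtinRep_of_isUnramifiedAt_holds`, `condUnramifiedRat_holds`). -/
theorem stub_modThree_of_fiveLeaves'
    (hd : strongArtin_of_isDihedralType) (ht : strongArtin_of_isTetrahedralType)
    (hdesc : cuspidal_descent_cyclic) (hL : tunnell_lemma)
    (hW1 : exists_isNewform1_of_isPiOfArtinRep) : SigStubModThree :=
  stub_modThree_of_fiveLeaves hd ht hdesc hL condUnramifiedRat_holds hW1

end Summit.ABC.ABC.Cruxes.FreyModularity.Sketch.StubIdeasModThreeK2G6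

end
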